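import Mathlib
import HarnessLib
import Literature.Analysis.FluidPDE.SelfSimilar
import Literature.Analysis.FluidPDE.VectorCalculus
import Literature.Analysis.FluidPDE.RadialCalculus
import Literature.Analysis.FluidPDE.ClassicalSolutionGalilean
import Literature.Analysis.FluidPDE.KNSSRegularityGalilean
import Literature.Analysis.FluidPDE.LerayProfileCalculus
import Literature.Analysis.FluidPDE.ClassicalSolution
import Literature.Analysis.FluidPDE.ClassicalSolutionCalculus
import Literature.Analysis.FluidPDE.SpaceTimeCalculus
import Literature.Analysis.FluidPDE.TaoEnstrophyLocalisation
import Literature.Analysis.UnboundedOperators.HeatKernel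
import Literature.Analysis.FluidPDE.NSBoundedMildOseen
import Summits.NavierStokesRegularity.NavierStokesRegularity.Theorems.PoloidalWindowDoorPoloidalWindowRigidityDecayingSlopeLiouvilleKeyBound

/-!
# Route `PoloidalWindowDoor`, crux `PoloidalWindowRigidity` (K2, stmt-NavierStokesRegularity-19708), line `slicesharp-screw` —
# STUB L4 `stub_decayingSlopeLiouville`: the ANCIENT DECAYING-SLOPE LIOUVILLE LEMMA (CENSUS-K2G §12, Lemma 12.1)

Cell ns-regularity-ideate, K2 lead nsreg-p7 (registered stub of the reshaped skeleton; `--supports stmt-…-19708`).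

THE LEMMA.  Along a profile `v` of the route's Type-I class (`‖v(t)‖ ≤ C/√(−t)`), a scalar `θ`, jointly `C²` on the open
slab, solving `∂ₜθ + (v·∇)θ − Δθ = c(t)` with a source depending on time only, whose slope about `x₀` decays —
`|θ(t,x) − θ(t,x₀)| ≤ ε(t)‖x − x₀‖`, `ε` continuous on `(−∞,0)`, `ε(t)√(−t) → 0` as `t → −∞` — is constant on every
slice.  (Application, in `…ScrewAssembly`: `θ = v·h` for a screw-invariant poloidal profile; `ε(t) = C₂/(−t)` from
`…ClassRate`; conclusion `curl v ≡ 0`, `v ≡ 0` — the helical stratum of the residue is empty.)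

PROOF (M8, the decaying-slope barrier).  Fix `t₁ < 0` and `t₀ < t₁`; `w(t,y) := θ(t,y) − θ(t₀,x₀) − ∫_{t₀}^t c` solves
the homogeneous drift–diffusion equation with `|w(t₀,y)| ≤ ε(t₀)‖y − x₀‖`.  The barrier
`Ψ(t,y) = ε(t₀)[(‖y−x₀‖² + 3|t₀|)^{1/2} + 4C(√(−t₀) − √(−t)) + (t − t₀)·3/√(3|t₀|)]` has `‖∇Ψ‖ ≤ ε(t₀)`,
`ΔΨ ≤ 3ε(t₀)/√(3|t₀|)` (radial calculus, Part A) and `Ψₜ = ε(t₀)[2C/√(−t) + 3/√(3|t₀|)]`, so it is a super-barrier for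
every drift bound `A ≤ 2C/√(−t)`; on the DYADIC BLOCKS `[s, s/4]` the class bound `‖v‖ ≤ C/√(−t) ≤ C/√(−s/4) =: A`
satisfies exactly that, and the whole-space comparison in the linear-growth class (STUB L4a, tree
`…WholeSpaceComparison.stub_wholeSpaceComparison`, ns-poloidal-K2-p3) carries `|w| ≤ Ψ` block by block from `t₀` to `t₁`
(Part E, `key_bound`).  Hence `|θ(t₁,x) − θ(t₁,x₀)| ≤ Ψ(t₁,x) + Ψ(t₁,x₀) ≤ ε(t₀)‖x−x₀‖ + 2(2√3 + 4C)·ε(t₀)√(−t₀) → 0`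
as `t₀ → −∞` (Part F).  Part B is the `C²` space–time bookkeeping (slice derivatives, continuity of `∂ₜθ`, `∇θ`, `Δθ`
in `t`), Part D the barrier's clock.

WHAT THIS IS NOT: not a claim about Navier–Stokes regularity — one registered stub (a linear parabolic Liouville lemma)
of the K2 line of a door route (bears_on LADDER-NS N0, rung N0-LocalTubeDoorPoloidal).
-/

noncomputable section

set_option linter.dupNamespace false

namespace Summit.NavierStokesRegularity.NavierStokesRegularity.Theorems.PoloidalWindowDoorPoloidalWindowRigidityDecayingSlopeLiouville

open Set Function Filter Topology Metric InnerProductSpace MeasureTheory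
open scoped RealInnerProductSpace Laplacian
open Literature.Analysis Literature.Analysis.FluidPDE
open Summit.NavierStokesRegularity.NavierStokesRegularity.Theorems.PoloidalWindowDoorPoloidalWindowRigidityDecayingSlopeLiouvilleBarrier
open Summit.NavierStokesRegularity.NavierStokesRegularity.Theorems.PoloidalWindowDoorPoloidalWindowRigidityDecayingSlopeLiouvilleSlab
open Summit.NavierStokesRegularity.NavierStokesRegularity.Theorems.PoloidalWindowDoorPoloidalWindowRigidityDecayingSlopeLiouvilleKeyBound

/-! ### Part F — THE STUB -/

section Stub

/-- **STUB L4 `stub_decayingSlopeLiouville` (CENSUS-K2G §12, Lemma 12.1 — the ancient decaying-slope Liouville lemma),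
registered signature of the line `slicesharp-screw` (skeleton rev 4/6).**  Along a profile of the route's Type-I class, a
scalar `θ`, jointly `C²` on the open slab, solving `∂ₜθ + (v·∇)θ − Δθ = c(t)` with a source depending on time only, whose
slope about `x₀` decays (`|θ(t,x) − θ(t,x₀)| ≤ ε(t)‖x − x₀‖`, `ε` continuous on `(−∞,0)`, `ε(t)√(−t) → 0` as `t → −∞`),
is constant on every slice.  Proof: `key_bound` at `t₁` for `x` and `x₀` gives
`|θ(t₁,x) − θ(t₁,x₀)| ≤ ε(t₀)‖x − x₀‖ + 2ε(t₀)√(−t₀)(2√3 + 4C)` for every `t₀ < t₁`, and the right side tends to `0`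
as `t₀ → −∞`. -/
theorem stub_decayingSlopeLiouville :
    ∀ (C : ℝ) (v : ℝ → EuclideanSpace ℝ (Fin 3) → EuclideanSpace ℝ (Fin 3)),
      Literature.Analysis.FluidPDE.HasTypeITimeDecay C v →
      ContinuousOn (Function.uncurry v) (Set.Iio (0 : ℝ) ×ˢ Set.univ) →
      (∀ s t : ℝ, s < t → t < 0 → ∀ x, v t x =
        Literature.Analysis.UnboundedOperators.heatExtension (v s) (t - s) x -
          Literature.Analysis.FluidPDE.oseenDuhamel 1 s v v t x) →
      (∀ t < 0, Literature.Analysis.FluidPDE.VectorCalculus.IsDivFree (v t)) →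
      ∀ (θ : ℝ → EuclideanSpace ℝ (Fin 3) → ℝ) (src : ℝ → ℝ) (x₀ : EuclideanSpace ℝ (Fin 3)) (ε : ℝ → ℝ),
      ContDiffOn ℝ 2 (Function.uncurry θ) (Set.Iio (0 : ℝ) ×ˢ Set.univ) →
      (∀ t < 0, ∀ x, deriv (fun τ => θ τ x) t + fderiv ℝ (θ t) x (v t x) - (Δ (θ t)) x = src t) →
      (∀ t < 0, ∀ x, |θ t x - θ t x₀| ≤ ε t * ‖x - x₀‖) →
      ContinuousOn ε (Set.Iio 0) →
      Filter.Tendsto (fun t => ε t * Real.sqrt (-t)) Filter.atBot (nhds 0) →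
      ∀ t < 0, ∀ x, θ t x = θ t x₀ := by
  intro C v hrate hcont _ _ θ src x₀ ε hθ heq hslope hεc hεt t₁ ht₁ x
  have hnt₁ : 0 < -t₁ := neg_pos.2 ht₁
  have hC : 0 ≤ C := by
    have h := hrate (-1) (by norm_num) 0
    rw [neg_neg, Real.sqrt_one, div_one] at h
    exact (norm_nonneg _).trans h
  have hε0 : ∀ t < 0, 0 ≤ ε t := by
    intro t ht
    have h := hslope t ht (x₀ + EuclideanSpace.single 0 1)
    have hn : ‖x₀ + EuclideanSpace.single 0 (1:ℝ) - x₀‖ = 1 := by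
      rw [add_sub_cancel_left, PiLp.norm_single, norm_one]
    rw [hn, mul_one] at h
    exact (abs_nonneg _).trans h
  -- ## the bound for every `t₀ < t₁`
  set K : ℝ := 2 * Real.sqrt 3 + 4 * C with hK
  have hK0 : 0 ≤ K := by positivity
  have key : ∀ t₀, t₀ < t₁ →
      |θ t₁ x - θ t₁ x₀| ≤ ε t₀ * ‖x - x₀‖ + 2 * K * (ε t₀ * Real.sqrt (-t₀)) := by
    intro t₀ ht₀₁
    have ht₀ : t₀ < 0 := ht₀₁.trans ht₁
    have hnt₀ : 0 < -t₀ := neg_pos.2 ht₀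
    have hb := key_bound hrate hcont hθ heq hslope hεc ht₀₁ ht₁ t₁ (right_mem_Icc.2 ht₀₁.le)
    have h1 := hb x
    have h2 := hb x₀
    -- the barrier at `t₁`
    have hm : Real.sqrt (3 * (-t₀)) = Real.sqrt 3 * Real.sqrt (-t₀) := Real.sqrt_mul (by norm_num) _
    have hs3 : 0 < Real.sqrt 3 := Real.sqrt_pos.2 (by norm_num)
    have hst : 0 < Real.sqrt (-t₀) := Real.sqrt_pos.2 hnt₀
    have hclock : 4 * C * (Real.sqrt (-t₀) - Real.sqrt (-t₁)) + 3 / Real.sqrt (3 * (-t₀)) * (t₁ - t₀) ≤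
        (4 * C + Real.sqrt 3) * Real.sqrt (-t₀) := by
      have h3 : 3 / Real.sqrt (3 * (-t₀)) * (t₁ - t₀) ≤ 3 / Real.sqrt (3 * (-t₀)) * (-t₀) :=
        mul_le_mul_of_nonneg_left (by linarith) (by positivity)
      have h4 : 3 / Real.sqrt (3 * (-t₀)) * (-t₀) = Real.sqrt 3 * Real.sqrt (-t₀) := by
        rw [hm]
        have e1 : Real.sqrt 3 * Real.sqrt 3 = 3 := Real.mul_self_sqrt (by norm_num)
        have e2 : Real.sqrt (-t₀) * Real.sqrt (-t₀) = -t₀ := Real.mul_self_sqrt hnt₀.le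
        field_simp
        nlinarith [e1, e2]
      nlinarith [Real.sqrt_nonneg (-t₁), h3, h4]
    have hsq1 : Real.sqrt (‖x - x₀‖ ^ 2 + 3 * (-t₀)) ≤ ‖x - x₀‖ + Real.sqrt 3 * Real.sqrt (-t₀) := by
      have := sqrt_norm_sq_add_le (m := 3 * (-t₀)) (by positivity) (x - x₀)
      rwa [hm] at this
    have hsq2 : Real.sqrt (‖x₀ - x₀‖ ^ 2 + 3 * (-t₀)) = Real.sqrt 3 * Real.sqrt (-t₀) := by
      rw [sub_self, norm_zero, zero_pow two_ne_zero, zero_add, hm]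
    have hdiff : θ t₁ x - θ t₁ x₀ = (θ t₁ x - θ t₀ x₀ - ∫ τ in t₀..t₁, src τ) -
        (θ t₁ x₀ - θ t₀ x₀ - ∫ τ in t₀..t₁, src τ) := by ring
    rw [hdiff]
    refine (abs_sub _ _).trans ?_
    have hε := hε0 t₀ ht₀
    calc |θ t₁ x - θ t₀ x₀ - ∫ τ in t₀..t₁, src τ| + |θ t₁ x₀ - θ t₀ x₀ - ∫ τ in t₀..t₁, src τ|
        ≤ ε t₀ * (Real.sqrt (‖x - x₀‖ ^ 2 + 3 * (-t₀)) +
            (4 * C * (Real.sqrt (-t₀) - Real.sqrt (-t₁)) + 3 / Real.sqrt (3 * (-t₀)) * (t₁ - t₀))) +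
          ε t₀ * (Real.sqrt (‖x₀ - x₀‖ ^ 2 + 3 * (-t₀)) +
            (4 * C * (Real.sqrt (-t₀) - Real.sqrt (-t₁)) + 3 / Real.sqrt (3 * (-t₀)) * (t₁ - t₀))) :=
          add_le_add h1 h2
      _ ≤ ε t₀ * (‖x - x₀‖ + Real.sqrt 3 * Real.sqrt (-t₀) + (4 * C + Real.sqrt 3) * Real.sqrt (-t₀)) +
          ε t₀ * (Real.sqrt 3 * Real.sqrt (-t₀) + (4 * C + Real.sqrt 3) * Real.sqrt (-t₀)) := by
          rw [hsq2]
          exact add_le_add (mul_le_mul_of_nonneg_left (add_le_add hsq1 hclock) hε)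
            (mul_le_mul_of_nonneg_left (add_le_add le_rfl hclock) hε)
      _ = ε t₀ * ‖x - x₀‖ + 2 * K * (ε t₀ * Real.sqrt (-t₀)) := by rw [hK]; ring
  -- ## the right side tends to `0` as `t₀ → −∞`
  have hεlim : Tendsto ε atBot (𝓝 0) := by
    have hle : ∀ᶠ t in atBot, ε t ≤ ε t * Real.sqrt (-t) := by
      filter_upwards [Iic_mem_atBot (-1 : ℝ)] with t ht
      have h1 : 1 ≤ Real.sqrt (-t) := by
        rw [show (1:ℝ) = Real.sqrt 1 by rw [Real.sqrt_one]]
        exact Real.sqrt_le_sqrt (by have := mem_Iic.1 ht; linarith)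
      have := hε0 t (by have := mem_Iic.1 ht; linarith)
      nlinarith
    have hge : ∀ᶠ t in atBot, 0 ≤ ε t := by
      filter_upwards [Iio_mem_atBot (0 : ℝ)] with t ht using hε0 t ht
    exact tendsto_of_tendsto_of_tendsto_of_le_of_le' tendsto_const_nhds hεt hge hle
  have hlim : Tendsto (fun t₀ => ε t₀ * ‖x - x₀‖ + 2 * K * (ε t₀ * Real.sqrt (-t₀))) atBot (𝓝 0) := by
    have h1 : Tendsto (fun t₀ => ε t₀ * ‖x - x₀‖) atBot (𝓝 (0 * ‖x - x₀‖)) := hεlim.mul_const _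
    have h2 : Tendsto (fun t₀ => 2 * K * (ε t₀ * Real.sqrt (-t₀))) atBot (𝓝 (2 * K * 0)) := hεt.const_mul _
    rw [zero_mul] at h1
    rw [mul_zero] at h2
    simpa using h1.add h2
  -- ## conclusion
  by_contra hne
  have hpos : 0 < |θ t₁ x - θ t₁ x₀| := abs_pos.2 (sub_ne_zero.2 hne)
  have hev : ∀ᶠ t₀ in atBot, ε t₀ * ‖x - x₀‖ + 2 * K * (ε t₀ * Real.sqrt (-t₀)) < |θ t₁ x - θ t₁ x₀| :=
    (tendsto_order.1 hlim).2 _ hpos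
  obtain ⟨t₀, ht₀lt, ht₀⟩ := (hev.and (Iio_mem_atBot t₁)).exists
  exact absurd (key t₀ ht₀) (not_le.2 ht₀lt)

end Stub

end Summit.NavierStokesRegularity.NavierStokesRegularity.Theorems.PoloidalWindowDoorPoloidalWindowRigidityDecayingSlopeLiouville

end
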